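import Literature.Computability.FineGrained.APSPPowerDriver
import Literature.Computability.FineGrained.MinPlusToNegativeTriangleGadget
import HarnessLib

/-!
# Distance product `≤₃` Negative Triangle (VW–W 2018, Thm. 4.2): the product step, program text

The word-RAM product step `psNT c` of the reduction APSP `≤₃` Negative Triangle
(Vassilevska Williams–Williams, J. ACM 65 (2018), Thm. 1.1, direction (1) `≤₃` (3); in print APSP
`≤₃` distance product (§2 p. 27:8) `≤₃` Negative Triangle (Thm. 4.2, p. 27:14, proof pp. 27:17–18)),
as structured code (`SProg`) for the square-and-multiply driver of
`Literature.Computability.FineGrained.APSPPowerDriver` (contract `APSPPower.ProdSpec`). This module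
only contains the *parameters*, the *program text* and the *register conventions*; the semantics is
proved in the sequel modules (`…Query`, `…Search`, `…Step`).

The step computes the codes of `X ⋆ Y` for `n × n` operands with `n^{c+1}`-bounded entries from an
oracle for Negative Triangle, following the printed proof:

* **simultaneous binary search** (proof of Thm. 4.2, p. 27:17: "We will binary search on `[-W, W]`
  for the finite entries of `C` … maintain two `n × n` matrices `S` and `H`"), here in dyadic form:
  a lower bound `lo[i, j]` and the current bit `pw = 2^r`, `K = size (4M + 1)` rounds
  (`Literature.Computability.FineGrained.NegTriStep.lo_step`);
* in each round, the pairs whose searched value lies below the threshold `lo + pw` are exactly the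
  pairs on a negative triangle of the tripartite query graph (p. 27:17: "`w(i, k) = A[i, k]`,
  `w(k, j) = B[k, j]` and `w(i, j) = -(S[i, j] + H[i, j])/2`"; the graph `QData.qmat` of
  `…MinPlusToNegativeTriangleGadget`), and they are all found by the **edge-deleting search on
  triples of blocks** of side `L = ⌈n^{1/3}⌉` of the proof of Lemma 4.2 (pp. 27:16–17: "For each
  triple `(I', J', K')` in turn … repeatedly uses Lemma 4.1 to return a negative triangle … removes
  edge `(i, j)` … until `G'` contains no negative triangles, in which case algorithm A moves on to
  the next triple"), a found pair being located inside a detecting triple by **bisection** of the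
  row window and then of the column window (in place of the recursive halving of Lemma 4.1,
  pp. 27:14–15; `2 ⌈log₂ L⌉` detection queries instead of `O(1)` amortised, which is immaterial for
  subcubicity);
* every query is rebuilt from scratch (`buildQ`: `9L²` cells, `O(1)` operations each), so that the
  step uses `O(n² log n · log M)` queries of size `3L = O(n^{1/3})` and time `Õ(n^{8/3})`.

Contents: `cubeRt` (the block side) and its elementary properties, the register map (`KRegs`,
`WRegs`), and the programs `cellBody`/`buildQ`/`ask` (one query), `bisRows`/`bisCols`/`markOps`
(locating and deleting a found pair), `search` (one round over all block triples), `loUpd` (the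
dyadic update of the lower bounds), `rounds`, `decode` (codes of `X ⋆ Y` from the searched values,
`encode_of_tval`), `setup` and `psNT`.

## References

* V. Vassilevska Williams, R. R. Williams, *Subcubic equivalences between path, matrix, and
  triangle problems*, J. ACM 65 (2018), Art. 27: Thm. 4.2 (p. 27:14; proof pp. 27:17–18),
  Lemma 4.1 (pp. 27:14–15), Lemma 4.2 (p. 27:16; proof pp. 27:16–17). doi:10.1145/3186893
* V. Vassilevska Williams, *On some fine-grained questions in algorithms and complexity*,
  Proc. ICM 2018, §2, Def. 2.1 (fine-grained reductions on the word RAM).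
-/

namespace Literature.Computability.FineGrained.NegTriStep

open Cryptography Cryptography.WordRAM Cryptography.WordRAM.SProg Matrix

/-! ## Parameters -/

/-- `n ≤ n³`. [folklore] -/
theorem le_cube (n : ℕ) : n ≤ n * n * n := by
  rcases Nat.eq_zero_or_pos n with rfl | hn
  · simp
  · calc n = 1 * 1 * n := by ring
      _ ≤ n * n * n := Nat.mul_le_mul_right _ (Nat.mul_le_mul hn hn)

/-- There is an `L` with `n ≤ L³`. [folklore] -/
theorem exists_le_cube (n : ℕ) : ∃ L, n ≤ L * L * L := ⟨n, le_cube n⟩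

/-- **The block side** `L = ⌈n^{1/3}⌉`: the least `L` with `n ≤ L³` (VW–W 2018, proof of Lemma 4.2
with `a = 2/3`: parts of `n^{1-a} = n^{1/3}` nodes). [folklore] -/
def cubeRt (n : ℕ) : ℕ := Nat.find (exists_le_cube n)

/-- `n ≤ (cubeRt n)³`. [folklore] -/
theorem le_cubeRt_cube (n : ℕ) : n ≤ cubeRt n * cubeRt n * cubeRt n := Nat.find_spec (exists_le_cube n)

/-- Minimality: `L³ < n` for `L < cubeRt n`. [folklore] -/
theorem cube_lt_of_lt_cubeRt {n L : ℕ} (h : L < cubeRt n) : L * L * L < n :=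
  Nat.lt_of_not_le (Nat.find_min (exists_le_cube n) h)

/-- `cubeRt n ≤ n`. [folklore] -/
theorem cubeRt_le (n : ℕ) : cubeRt n ≤ n := Nat.find_min' _ (le_cube n)

/-- `1 ≤ cubeRt n` for `1 ≤ n`. [folklore] -/
theorem one_le_cubeRt {n : ℕ} (hn : 1 ≤ n) : 1 ≤ cubeRt n := by
  by_contra h
  have h0 : cubeRt n = 0 := by omega
  have := le_cubeRt_cube n
  rw [h0] at this
  omega

/-- Characterisation: `cubeRt n = L` iff `n ≤ L³` and `L'³ < n` for all `L' < L`. [folklore] -/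
theorem cubeRt_eq_iff {n L : ℕ} : cubeRt n = L ↔ n ≤ L * L * L ∧ ∀ L', L' < L → L' * L' * L' < n := by
  unfold cubeRt
  rw [Nat.find_eq_iff]
  simp only [not_le]

/-- The number of blocks per side, `⌈n / L⌉`. [folklore] -/
def nblk (n : ℕ) : ℕ := (n + cubeRt n - 1) / cubeRt n

/-- `nblk n · L ≤ n + L - 1`. [folklore] -/
theorem nblk_mul_le (n : ℕ) : nblk n * cubeRt n ≤ n + cubeRt n - 1 := Nat.div_mul_le_self _ _

/-- A block start lies inside the matrix: `b · L < n` for `b < nblk n` (and `1 ≤ n`). [folklore] -/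
theorem blk_mul_lt {n b : ℕ} (hn : 1 ≤ n) (hb : b < nblk n) : b * cubeRt n < n := by
  have h1 := nblk_mul_le n
  have hL := one_le_cubeRt hn
  have : b * cubeRt n + cubeRt n ≤ nblk n * cubeRt n := by
    calc b * cubeRt n + cubeRt n = (b + 1) * cubeRt n := by ring
      _ ≤ nblk n * cubeRt n := Nat.mul_le_mul_right _ hb
  omega

/-- `nblk n ≤ n`. [folklore] -/
theorem nblk_le {n : ℕ} (hn : 1 ≤ n) : nblk n ≤ n := by
  have hL := one_le_cubeRt hn
  unfold nblk
  rw [Nat.div_le_iff_le_mul_add_pred hL]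
  have h1 : n ≤ cubeRt n * n := Nat.le_mul_of_pos_left _ hL
  omega

/-- Every index lies in some block: `i / L < nblk n` for `i < n`. [folklore] -/
theorem div_lt_nblk {n i : ℕ} (hn : 1 ≤ n) (hi : i < n) : i / cubeRt n < nblk n :=
  div_lt_blocks (one_le_cubeRt hn) hi

/-- The entry bound `M = n^{c+1}` of the operands handed over by the driver. [folklore] -/
def bndM (c n : ℕ) : ℕ := n ^ (c + 1)

/-- The number of rounds of the binary search, `K = size (4M + 1)` (so that `P = 2^K ≥ 4M + 2`
exceeds every searched value, `tval_lt`). [folklore] -/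
def nRounds (c n : ℕ) : ℕ := Nat.size (4 * bndM c n + 1)

/-- The top power of two `P = 2^K`. [folklore] -/
def topP (c n : ℕ) : ℕ := 2 ^ nRounds c n

/-- `4M + 2 ≤ P`. [folklore] -/
theorem four_mul_add_two_le_topP (c n : ℕ) : 4 * bndM c n + 2 ≤ topP c n :=
  Nat.lt_size_self _

/-- `P ≤ 8M + 2`. [folklore] -/
theorem topP_le (c n : ℕ) : topP c n ≤ 8 * bndM c n + 2 := by
  have h : 2 ^ (Nat.size (4 * bndM c n + 1) - 1) ≤ 4 * bndM c n + 1 := by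
    have hs : 0 < Nat.size (4 * bndM c n + 1) := Nat.size_pos.2 (by omega)
    exact Nat.lt_size.1 (by omega)
  have hs : 0 < Nat.size (4 * bndM c n + 1) := Nat.size_pos.2 (by omega)
  unfold topP nRounds
  calc 2 ^ Nat.size (4 * bndM c n + 1) = 2 ^ (Nat.size (4 * bndM c n + 1) - 1) * 2 := by
        rw [← pow_succ]; congr 1; omega
    _ ≤ 8 * bndM c n + 2 := by omega

/-- The workspace of one call: the two `n²`-arrays `lo`, `fd`, the query buffer (`9L² + 1` words)
and the two answer words. [folklore] -/
def wspNT (n : ℕ) : ℕ := 2 * (n * n) + 9 * (cubeRt n * cubeRt n) + 3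

/-! ## Register conventions

Registers are the cells `< 100` of `merge S H`. The driver hands over `r2 = n`, `r9 = F` (free
pointer), `r16 = pX`, `r17 = pY` and requires `r0 … r11` back unchanged except `r9`. The step
keeps its constants in `r20 … r39` (`KRegs`), the block triple and the windows of the current
query in `r42 … r48` (`WRegs`), and uses `r40, r41` (triple counter), `r49` (oracle answer),
`r50 … r52` (bisection), `r60 … r85` (query building) and `r90 … r92` (array sweeps) as
temporaries. -/

/-- **The constant registers** after the setup: `r2 = n`, `r9 = F`, `r16 = pX`, `r17 = pY`
(from the driver), `r20 = M`, `r21 = 2M`, `r22 = 4M`, `r23 = 2 big M + 1` (the code of a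
non-edge), `r24 = pw` (the current bit), `r25 = L`, `r26 = 3L`, `r27 = 9L² + 1`, `r28 = nb`,
`r29 = nb²`, `r30 = nb³`, `r31 = pLO = F`, `r32 = pFD = F + n²`, `r33 = pQ = F + 2n²`,
`r34 = pQ + 1`, `r35 = pA = pQ + 9L² + 1`, `r36 = n²`, `r37 = pX + 1`, `r38 = pY + 1`,
`r39 = 9L²`. [folklore] -/
structure KRegs (n F pX pY M L nb pw : ℕ) (S : ℕ → ℕ) : Prop where
  r2 : S 2 = n
  r9 : S 9 = F
  r16 : S 16 = pX
  r17 : S 17 = pY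
  r20 : S 20 = M
  r21 : S 21 = 2 * M
  r22 : S 22 = 4 * M
  r23 : S 23 = 2 * big M + 1
  r24 : S 24 = pw
  r25 : S 25 = L
  r26 : S 26 = 3 * L
  r27 : S 27 = 9 * (L * L) + 1
  r28 : S 28 = nb
  r29 : S 29 = nb * nb
  r30 : S 30 = nb * nb * nb
  r31 : S 31 = F
  r32 : S 32 = F + n * n
  r33 : S 33 = F + 2 * (n * n)
  r34 : S 34 = F + 2 * (n * n) + 1
  r35 : S 35 = F + 2 * (n * n) + (9 * (L * L) + 1)
  r36 : S 36 = n * n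
  r37 : S 37 = pX + 1
  r38 : S 38 = pY + 1
  r39 : S 39 = 9 * (L * L)

/-- The constant registers survive any change of the registers `≥ 40`. [folklore] -/
theorem KRegs.of_agree {n F pX pY M L nb pw : ℕ} {S S' : ℕ → ℕ} (h : KRegs n F pX pY M L nb pw S)
    (hag : ∀ r, r < 40 → S' r = S r) : KRegs n F pX pY M L nb pw S' := by
  obtain ⟨h2, h9, h16, h17, h20, h21, h22, h23, h24, h25, h26, h27, h28, h29, h30, h31, h32, h33, h34,
    h35, h36, h37, h38, h39⟩ := h
  exact ⟨(hag 2 (by norm_num)).trans h2, (hag 9 (by norm_num)).trans h9,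
    (hag 16 (by norm_num)).trans h16, (hag 17 (by norm_num)).trans h17,
    (hag 20 (by norm_num)).trans h20, (hag 21 (by norm_num)).trans h21,
    (hag 22 (by norm_num)).trans h22, (hag 23 (by norm_num)).trans h23,
    (hag 24 (by norm_num)).trans h24, (hag 25 (by norm_num)).trans h25,
    (hag 26 (by norm_num)).trans h26, (hag 27 (by norm_num)).trans h27,
    (hag 28 (by norm_num)).trans h28, (hag 29 (by norm_num)).trans h29,
    (hag 30 (by norm_num)).trans h30, (hag 31 (by norm_num)).trans h31,
    (hag 32 (by norm_num)).trans h32, (hag 33 (by norm_num)).trans h33,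
    (hag 34 (by norm_num)).trans h34, (hag 35 (by norm_num)).trans h35,
    (hag 36 (by norm_num)).trans h36, (hag 37 (by norm_num)).trans h37,
    (hag 38 (by norm_num)).trans h38, (hag 39 (by norm_num)).trans h39⟩

/-- Changing the current bit `r24`. [folklore] -/
theorem KRegs.set_pw {n F pX pY M L nb pw pw' : ℕ} {S : ℕ → ℕ} (h : KRegs n F pX pY M L nb pw S) :
    KRegs n F pX pY M L nb pw' (Function.update S 24 pw') := by
  obtain ⟨h2, h9, h16, h17, h20, h21, h22, h23, h24, h25, h26, h27, h28, h29, h30, h31, h32, h33, h34,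
    h35, h36, h37, h38, h39⟩ := h
  refine ⟨?_, ?_, ?_, ?_, ?_, ?_, ?_, ?_, ?_, ?_, ?_, ?_, ?_, ?_, ?_, ?_, ?_, ?_, ?_, ?_, ?_, ?_, ?_, ?_⟩ <;>
    simp [*]

/-- **The registers of the current query**: block triple `r42 = bi`, `r43 = bj`, `r44 = bk` and
windows `r45 = rlo`, `r46 = rhi`, `r47 = clo`, `r48 = chi`. [folklore] -/
structure WRegs (bi bj bk rlo rhi clo chi : ℕ) (S : ℕ → ℕ) : Prop where
  r42 : S 42 = bi
  r43 : S 43 = bj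
  r44 : S 44 = bk
  r45 : S 45 = rlo
  r46 : S 46 = rhi
  r47 : S 47 = clo
  r48 : S 48 = chi

/-- The query registers survive any change of the other registers. [folklore] -/
theorem WRegs.of_agree {bi bj bk rlo rhi clo chi : ℕ} {S S' : ℕ → ℕ}
    (h : WRegs bi bj bk rlo rhi clo chi S) (hag : ∀ r, 42 ≤ r → r ≤ 48 → S' r = S r) :
    WRegs bi bj bk rlo rhi clo chi S' := by
  obtain ⟨h42, h43, h44, h45, h46, h47, h48⟩ := h
  exact ⟨(hag 42 (by norm_num) (by norm_num)).trans h42, (hag 43 (by norm_num) (by norm_num)).trans h43,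
    (hag 44 (by norm_num) (by norm_num)).trans h44, (hag 45 (by norm_num) (by norm_num)).trans h45,
    (hag 46 (by norm_num) (by norm_num)).trans h46, (hag 47 (by norm_num) (by norm_num)).trans h47,
    (hag 48 (by norm_num) (by norm_num)).trans h48⟩

/-! ## The program

### Building and asking one query -/

/-- Decoding the cell number `m = r60` of the query matrix (`3L × 3L`, row-major): `u = m / 3L`,
`v = m mod 3L`, their parts `pu = u / L`, `pv = v / L` and local indices `iu = u mod L`,
`iv = v mod L`, the selector `sel = 3 pu + pv`, and the default code (a non-edge). [folklore] -/
def decodeOps : List OpSpec :=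
  [(.div, .dir 62, .dir 60, .dir 26), (.mod, .dir 63, .dir 60, .dir 26),
    (.div, .dir 64, .dir 62, .dir 25), (.mod, .dir 65, .dir 62, .dir 25),
    (.div, .dir 66, .dir 63, .dir 25), (.mod, .dir 67, .dir 63, .dir 25),
    (.mul, .dir 68, .dir 64, .imm 3), (.add, .dir 68, .dir 68, .dir 66),
    (.add, .dir 69, .dir 23, .imm 0)]

/-- An arc weighted by an operand entry (rows → middles by `X`, middles → columns by `Y`), first
half: the global indices `g1 = rb · L + iu`, `g2 = cb · L + iv` (`rb = r71`, `cb = r72` the two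
blocks) and the range test `cc = [g1 < n] · [g2 < n]`. [folklore] -/
def arcXYOps1 : List OpSpec :=
  [(.mul, .dir 74, .dir 71, .dir 25), (.add, .dir 74, .dir 74, .dir 65),
    (.mul, .dir 75, .dir 72, .dir 25), (.add, .dir 75, .dir 75, .dir 67),
    (.lt, .dir 76, .dir 74, .dir 2), (.lt, .dir 77, .dir 75, .dir 2),
    (.mul, .dir 77, .dir 76, .dir 77)]

/-- Second half: the stored code `cx` of the entry `(g1, g2)` of the operand block at `base = r73`. [folklore] -/
def arcXYOps2 : List OpSpec :=
  [(.mul, .dir 78, .dir 74, .dir 2), (.add, .dir 78, .dir 78, .dir 75),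
    (.add, .dir 78, .dir 78, .dir 73), (.add, .dir 79, .ind 78, .imm 0)]

/-- The code of an operand arc: the stored code of the entry if it is in range and finite (nonzero
code), the non-edge code otherwise (`QData.entryOr`). [folklore] -/
def arcXY : SProg :=
  seq (block arcXYOps1) (ifz (.dir 77) skip
    (seq (block arcXYOps2) (ifz (.dir 79) skip (op .add (.dir 69) (.dir 79) (.imm 0)))))

/-- A back arc (columns → rows), first part: the global row `gi = bi L + iv` and column
`gj = bj L + iu` and the activity test `acc = [gi < n][gj < n][rlo ≤ iv < rhi][clo ≤ iu < chi]`
(`QData.Active` without the found test). [folklore] -/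
def arcTOps1 : List OpSpec :=
  [(.mul, .dir 74, .dir 42, .dir 25), (.add, .dir 74, .dir 74, .dir 67),
    (.mul, .dir 75, .dir 43, .dir 25), (.add, .dir 75, .dir 75, .dir 65),
    (.lt, .dir 80, .dir 74, .dir 2),
    (.lt, .dir 76, .dir 75, .dir 2), (.mul, .dir 80, .dir 80, .dir 76),
    (.lt, .dir 76, .dir 67, .dir 45), (.sub, .dir 76, .imm 1, .dir 76), (.mul, .dir 80, .dir 80, .dir 76),
    (.lt, .dir 76, .dir 67, .dir 46), (.mul, .dir 80, .dir 80, .dir 76),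
    (.lt, .dir 76, .dir 65, .dir 47), (.sub, .dir 76, .imm 1, .dir 76), (.mul, .dir 80, .dir 80, .dir 76),
    (.lt, .dir 76, .dir 65, .dir 48), (.mul, .dir 80, .dir 80, .dir 76)]

/-- Second part: the pair index `idx = gi n + gj` and the found test `e = [fd[idx] = pw]`. [folklore] -/
def arcTOps2 : List OpSpec :=
  [(.mul, .dir 81, .dir 74, .dir 2), (.add, .dir 81, .dir 81, .dir 75),
    (.add, .dir 78, .dir 32, .dir 81), (.add, .dir 82, .ind 78, .imm 0),
    (.eq, .dir 82, .dir 82, .dir 24)]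

/-- Third part: the threshold `s = lo[idx] + pw` and the sign `b = [2M < s]` of the weight
`2M - s`. [folklore] -/
def arcTOps3 : List OpSpec :=
  [(.add, .dir 78, .dir 31, .dir 81), (.add, .dir 83, .ind 78, .imm 0),
    (.add, .dir 83, .dir 83, .dir 24), (.lt, .dir 84, .dir 21, .dir 83)]

/-- The code `2 (2M - s) + 1` of the nonnegative weight `2M - s`. [folklore] -/
def arcTPos : List OpSpec :=
  [(.sub, .dir 69, .dir 21, .dir 83), (.add, .dir 69, .dir 69, .dir 69), (.add, .dir 69, .dir 69, .imm 1)]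

/-- The code `2 (s - 2M)` of the negative weight `2M - s`. [folklore] -/
def arcTNeg : List OpSpec :=
  [(.sub, .dir 69, .dir 83, .dir 21), (.add, .dir 69, .dir 69, .dir 69)]

/-- The code of a back arc: the zig-zag code of the negated threshold `2M - (lo + pw)` of an active
pair, the non-edge code otherwise (`QData.tarc`). [folklore] -/
def arcT : SProg :=
  seq (block arcTOps1) (ifz (.dir 80) skip
    (seq (block arcTOps2) (ifz (.dir 82)
      (seq (block arcTOps3) (ifz (.dir 84) (block arcTPos) (block arcTNeg)))
      skip)))

/-- Selecting the operand blocks of an `X`-arc: rows `bi`, columns `bk`, base `pX + 1`. [folklore] -/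
def selXOps : List OpSpec :=
  [(.add, .dir 71, .dir 42, .imm 0), (.add, .dir 72, .dir 44, .imm 0), (.add, .dir 73, .dir 37, .imm 0)]

/-- Selecting the operand blocks of a `Y`-arc: rows `bk`, columns `bj`, base `pY + 1`. [folklore] -/
def selYOps : List OpSpec :=
  [(.add, .dir 71, .dir 44, .imm 0), (.add, .dir 72, .dir 43, .imm 0), (.add, .dir 73, .dir 38, .imm 0)]

/-- Writing the code of cell `m` and advancing. [folklore] -/
def writeOps : List OpSpec :=
  [(.add, .dir 78, .dir 34, .dir 60), (.add, .ind 78, .dir 69, .imm 0),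
    (.add, .dir 60, .dir 60, .imm 1), (.sub, .dir 61, .dir 61, .imm 1)]

/-- **One cell of the query matrix**: decode, dispatch on the selector (`1`: an `X`-arc, `5`: a
`Y`-arc, `6`: a back arc, otherwise a non-edge), write. [folklore] -/
def cellBody : SProg :=
  seqs [block decodeOps,
    block [(.eq, .dir 70, .dir 68, .imm 1)], ifz (.dir 70) skip (seq (block selXOps) arcXY),
    block [(.eq, .dir 70, .dir 68, .imm 5)], ifz (.dir 70) skip (seq (block selYOps) arcXY),
    block [(.eq, .dir 70, .dir 68, .imm 6)], ifz (.dir 70) skip arcT,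
    block writeOps]

/-- **Building the query**: the header `3L` and the `9L²` cells. [folklore] -/
def buildQ : SProg :=
  seq (block [(.add, .dir 60, .imm 0, .imm 0), (.add, .dir 61, .dir 39, .imm 0),
      (.add, .ind 33, .dir 26, .imm 0)])
    (whilenz (.dir 61) cellBody)

/-- **One detection query** on the current block triple and windows: build, ask the oracle (answer
written at `pA`), fetch the answer bit into `r49`. [folklore] -/
def ask : SProg :=
  seqs [buildQ, query (.dir 33) (.dir 27) (.dir 35),
    block [(.add, .dir 78, .dir 35, .imm 1), (.add, .dir 49, .ind 78, .imm 0)]]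

/-! ### Locating a witness pair by bisection, and deleting it -/

/-- One bisection step on the row window `[rlo, rhi)`: query the lower half; keep it on a yes, move
to the upper half on a no; recompute the width test `r50 = rhi - rlo - 1`. [folklore] -/
def bisRowsBody : SProg :=
  seqs [block [(.add, .dir 51, .dir 45, .dir 46), (.shr, .dir 51, .dir 51, .imm 1),
      (.add, .dir 52, .dir 46, .imm 0), (.add, .dir 46, .dir 51, .imm 0)],
    ask,
    ifz (.dir 49) (block [(.add, .dir 45, .dir 51, .imm 0), (.add, .dir 46, .dir 52, .imm 0)]) skip,
    block [(.sub, .dir 50, .dir 46, .dir 45), (.sub, .dir 50, .dir 50, .imm 1)]]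

/-- Bisection of the row window down to a single row containing a witness pair. [folklore] -/
def bisRows : SProg :=
  seq (block [(.sub, .dir 50, .dir 46, .dir 45), (.sub, .dir 50, .dir 50, .imm 1)])
    (whilenz (.dir 50) bisRowsBody)

/-- One bisection step on the column window `[clo, chi)`. [folklore] -/
def bisColsBody : SProg :=
  seqs [block [(.add, .dir 51, .dir 47, .dir 48), (.shr, .dir 51, .dir 51, .imm 1),
      (.add, .dir 52, .dir 48, .imm 0), (.add, .dir 48, .dir 51, .imm 0)],
    ask,
    ifz (.dir 49) (block [(.add, .dir 47, .dir 51, .imm 0), (.add, .dir 48, .dir 52, .imm 0)]) skip,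
    block [(.sub, .dir 50, .dir 48, .dir 47), (.sub, .dir 50, .dir 50, .imm 1)]]

/-- Bisection of the column window down to a single cell: a witness pair. [folklore] -/
def bisCols : SProg :=
  seq (block [(.sub, .dir 50, .dir 48, .dir 47), (.sub, .dir 50, .dir 50, .imm 1)])
    (whilenz (.dir 50) bisColsBody)

/-- Deleting the found pair `(bi L + rlo, bj L + clo)` for the rest of the round: stamp it with the
current bit in the found array (VW–W p. 27:16: "removes edge `(i, j)` from `G̃`"). [folklore] -/
def markOps : List OpSpec :=
  [(.mul, .dir 74, .dir 42, .dir 25), (.add, .dir 74, .dir 74, .dir 45),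
    (.mul, .dir 75, .dir 43, .dir 25), (.add, .dir 75, .dir 75, .dir 47),
    (.mul, .dir 81, .dir 74, .dir 2), (.add, .dir 81, .dir 81, .dir 75),
    (.add, .dir 78, .dir 32, .dir 81), (.add, .ind 78, .dir 24, .imm 0)]

/-! ### One round: all block triples, then the dyadic update -/

/-- Setting up the current triple `tr = r40` (`bi = tr / nb²`, `bj = tr / nb mod nb`,
`bk = tr mod nb`) with full windows. [folklore] -/
def tripleOps : List OpSpec :=
  [(.div, .dir 42, .dir 40, .dir 29), (.div, .dir 43, .dir 40, .dir 28), (.mod, .dir 43, .dir 43, .dir 28),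
    (.mod, .dir 44, .dir 40, .dir 28),
    (.add, .dir 45, .imm 0, .imm 0), (.add, .dir 46, .dir 25, .imm 0),
    (.add, .dir 47, .imm 0, .imm 0), (.add, .dir 48, .dir 25, .imm 0)]

/-- **One step of the search**: query the current triple with full windows; on a no move to the
next triple (`r41 = nb³ - tr` counts the remaining ones), on a yes locate a witness pair and delete
it (VW–W, proof of Lemma 4.2). [folklore] -/
def searchBody : SProg :=
  seqs [block tripleOps, ask,
    ifz (.dir 49)
      (block [(.add, .dir 40, .dir 40, .imm 1), (.sub, .dir 41, .dir 41, .imm 1)])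
      (seqs [bisRows, bisCols, block markOps])]

/-- **The search of one round** over all `nb³` block triples. [folklore] -/
def search : SProg :=
  seq (block [(.add, .dir 40, .imm 0, .imm 0), (.add, .dir 41, .dir 30, .imm 0)])
    (whilenz (.dir 41) searchBody)

/-- The dyadic update of one lower bound: `lo[t] += pw` unless the pair was found in this round
(`fd[t] = pw`), i.e. unless its value lies below `lo[t] + pw` (`lo_step`). Pointers `r90` (into
`lo`), `r91` (into `fd`), count `r92`. [folklore] -/
def loUpdOps : List OpSpec :=
  [(.add, .dir 82, .ind 91, .imm 0), (.eq, .dir 82, .dir 82, .dir 24),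
    (.sub, .dir 82, .imm 1, .dir 82), (.mul, .dir 82, .dir 82, .dir 24),
    (.add, .ind 90, .ind 90, .dir 82),
    (.add, .dir 90, .dir 90, .imm 1), (.add, .dir 91, .dir 91, .imm 1), (.sub, .dir 92, .dir 92, .imm 1)]

/-- The dyadic update of all lower bounds. [folklore] -/
def loUpd : SProg :=
  seq (block [(.add, .dir 90, .dir 31, .imm 0), (.add, .dir 91, .dir 32, .imm 0),
      (.add, .dir 92, .dir 36, .imm 0)])
    (whilenz (.dir 92) (block loUpdOps))

/-- **One round of the simultaneous binary search** (VW–W, proof of Thm. 4.2, one "iteration"):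
search, update, halve the bit. [folklore] -/
def roundBody : SProg :=
  seqs [search, loUpd, block [(.shr, .dir 24, .dir 24, .imm 1)]]

/-- All rounds: bits `P/2, P/4, …, 1`. [folklore] -/
def rounds : SProg :=
  seq (block [(.shr, .dir 24, .dir 24, .imm 1)]) (whilenz (.dir 24) roundBody)

/-! ### Decoding the result, setup, the whole step -/

/-- The code of one product entry from its searched value `T = lo[t]` (`encode_of_tval`): `0` (`⊤`)
if `4M < T`, else the zig-zag code of `T - 2M`; written over the code of the `X`-entry. Pointers
`r90` (into `lo`), `r91` (into the `X` block), count `r92`. [folklore] -/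
def decBody : SProg :=
  seqs [block [(.add, .dir 83, .ind 90, .imm 0), (.lt, .dir 84, .dir 22, .dir 83)],
    ifz (.dir 84)
      (seq (block [(.lt, .dir 85, .dir 83, .dir 21)])
        (ifz (.dir 85)
          (block [(.sub, .dir 69, .dir 83, .dir 21), (.add, .dir 69, .dir 69, .dir 69),
            (.add, .dir 69, .dir 69, .imm 1)])
          (block [(.sub, .dir 69, .dir 21, .dir 83), (.add, .dir 69, .dir 69, .dir 69)])))
      (block [(.add, .dir 69, .imm 0, .imm 0)]),
    block [(.add, .ind 91, .dir 69, .imm 0),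
      (.add, .dir 90, .dir 90, .imm 1), (.add, .dir 91, .dir 91, .imm 1), (.sub, .dir 92, .dir 92, .imm 1)]]

/-- Decoding all entries of `X ⋆ Y` into the `X` block. [folklore] -/
def decode : SProg :=
  seq (block [(.add, .dir 90, .dir 31, .imm 0), (.add, .dir 91, .dir 37, .imm 0),
      (.add, .dir 92, .dir 36, .imm 0)])
    (whilenz (.dir 92) decBody)

/-- The body of the loop computing `M = n^{c+1}` (`r20`, counter `r70`). [folklore] -/
def powMOps : List OpSpec := [(.mul, .dir 20, .dir 20, .dir 2), (.sub, .dir 70, .dir 70, .imm 1)]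

/-- The body of the loop computing `P = 2^{size (4M+1)}` (`r24`; `r70` is shifted out). [folklore] -/
def powPOps : List OpSpec := [(.shr, .dir 70, .dir 70, .imm 1), (.add, .dir 24, .dir 24, .dir 24)]

/-- The body of the loop computing `L = cubeRt n` (`r25`; `r70 = [L³ < n]`). [folklore] -/
def cubeOps : List OpSpec :=
  [(.add, .dir 25, .dir 25, .imm 1), (.mul, .dir 71, .dir 25, .dir 25), (.mul, .dir 71, .dir 71, .dir 25),
    (.lt, .dir 70, .dir 71, .dir 2)]

/-- Constants derived from `M`: `2M`, `4M`, the non-edge code `2 (16M + 4) + 1 = 32M + 9`; and the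
registers of the `P`-loop. [folklore] -/
def setupOps2 : List OpSpec :=
  [(.add, .dir 21, .dir 20, .dir 20), (.add, .dir 22, .dir 21, .dir 21),
    (.mul, .dir 23, .dir 22, .imm 8), (.add, .dir 23, .dir 23, .imm 9),
    (.add, .dir 70, .dir 22, .imm 1), (.add, .dir 24, .imm 1, .imm 0)]

/-- The registers of the `L`-loop. [folklore] -/
def setupOps3 : List OpSpec :=
  [(.add, .dir 25, .imm 0, .imm 0), (.lt, .dir 70, .imm 0, .dir 2)]

/-- The remaining constants: `3L`, `9L²`, `9L² + 1`, `nb = (n + L - 1) / L`, `nb²`, `nb³`, `n²`, and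
the layout `pLO = F`, `pFD`, `pQ`, `pQ + 1`, `pA`, `pX + 1`, `pY + 1`. [folklore] -/
def setupOps4 : List OpSpec :=
  [(.mul, .dir 26, .dir 25, .imm 3),
    (.mul, .dir 39, .dir 26, .dir 26), (.add, .dir 27, .dir 39, .imm 1),
    (.add, .dir 28, .dir 2, .dir 25), (.sub, .dir 28, .dir 28, .imm 1), (.div, .dir 28, .dir 28, .dir 25),
    (.mul, .dir 29, .dir 28, .dir 28), (.mul, .dir 30, .dir 29, .dir 28),
    (.mul, .dir 36, .dir 2, .dir 2),
    (.add, .dir 31, .dir 9, .imm 0), (.add, .dir 32, .dir 31, .dir 36),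
    (.add, .dir 33, .dir 32, .dir 36), (.add, .dir 34, .dir 33, .imm 1),
    (.add, .dir 35, .dir 33, .dir 27),
    (.add, .dir 37, .dir 16, .imm 1), (.add, .dir 38, .dir 17, .imm 1)]

/-- **The setup** of the constants `M, 2M, 4M, 32M + 9, P, L, 3L, 9L², 9L² + 1, nb, nb², nb³, n²`
and of the layout registers. [folklore] -/
def setup (c : ℕ) : SProg :=
  seqs [block [(.add, .dir 20, .imm 1, .imm 0), (.add, .dir 70, .imm (c + 1), .imm 0)],
    whilenz (.dir 70) (block powMOps), block setupOps2,
    whilenz (.dir 70) (block powPOps), block setupOps3,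
    whilenz (.dir 70) (block cubeOps), block setupOps4]

/-- **The product step through a Negative-Triangle oracle** (VW–W 2018, Thm. 4.2 as an oracle
program): setup, the rounds of the simultaneous binary search, decoding the product into the
first operand block, and advancing the free pointer past the workspace. [folklore] -/
def psNT (c : ℕ) : SProg :=
  seqs [setup c, rounds, decode, block [(.add, .dir 9, .dir 35, .imm 2)]]

/-- The product step is deterministic code. [folklore] -/
theorem psNT_isDeterministic (c : ℕ) : (psNT c).toProgram.IsDeterministic :=
  toProgram_isDeterministic _

end Literature.Computability.FineGrained.NegTriStep
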